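import Summits.KontsevichZagierPeriods.KontsevichZagierPeriods.Theorems.HermiteRigidityIslandComplementCubeReflection

/-!
# `ReductionRigidity` (stmt-KontsevichZagierPeriods-3407), line `Sketch`, stub `stub_islandComplement`:
# the Landen certificate, I — the regular rational primitives on `□³` (`stub_landenPrimitives`)

Route `KontsevichZagierPeriods/HermiteRigidity`, crux `ReductionRigidity` (stmt-3407); growth deliverable
G4 of `Cruxes/ReductionRigidity/STUB-PLAN-stub_islandComplement.md`, part 1 (registered sub-goal stub
`stub_landenPrimitives`). Landen's identity `Li₂(z) + Li₂(z/(z−1)) = −½ log²(1−z)` at `z = 1/N`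
becomes a chain of cubical moves through the extra variable `t ∈ [0,1]`, `z = t/N`. This file supplies
the seven regular rational functions on the closed cube `□³` (coordinates `x = p₀`, `y = p₁`,
`t = p₂`) of the certificate, with their values and the values of the relevant formal partial
derivatives (quotient rule, `KZ.RFun.pd`), in the shape of the EXACTNESS identities they satisfy:

* `F₁ = 2t/(N − xyt)`,      `G₁ = 2x/(N − xyt)`:                  `∂ₜF₁ = ∂ₓG₁ = 2N/(N − xyt)²`;
* `F₂ = −2t/(N − t + xyt)`, `G₂ = −2Nx/((N − t)(N − t + xyt))`:    `∂ₜF₂ = ∂ₓG₂ = −2N/(N − t + xyt)²`;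
* `F₃ = t²/((N − xt)(N − yt))`, `G₃ = xt/((N − xt)(N − yt))`, `H₃ = yt/((N − xt)(N − yt))`:
  `∂ₜF₃ = ∂ₓG₃ + ∂_yH₃` with `∂ₓG₃ = Nt/((N − xt)²(N − yt))`, `∂_yH₃ = Nt/((N − xt)(N − yt)²)`

(`Fₖ(x, y, t) = 2Eₖ(x, y, t/N)` for the dilogarithm kernels `E₁ = z/(1 − xyz)` of `Li₂(z)`,
`E₂ = −z/((1 − z) + xyz)` of `Li₂(z/(z − 1))`, `E₃ = ½z²/((1 − xz)(1 − yz))` of `½ log²(1 − z)`).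
All denominators are `≥ 1` on the closed cube for `N ≥ 2`, so every function is regular there; the
partial derivatives are computed symbolically (`rfun_pd_fn_eq`, `MvPolynomial.pderiv`).

References: M. Kontsevich, D. Zagier, *Periods* (2001), §1.2 [cite: KontsevichZagier2001, §1.2].
No definitions are introduced (the functions are delivered existentially with their values).
-/

noncomputable section

open MeasureTheory Set MvPolynomial

namespace Summit.KontsevichZagierPeriods.HermiteRigidity.ReductionRigidity

open Literature.NumberTheory.Transcendental
open Literature.NumberTheory.Transcendental.KZ

/-! ## Bounds on the closed cube `□³` -/

/-- On `□³` (`N ≥ 2`) the five denominators of the certificate are `≥ 1`: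
`N − xyt`, `N − t`, `N − t + xyt`, `N − xt`, `N − yt`. [folklore] -/
theorem landen_den_bounds {N : ℕ} (hN : 2 ≤ N) {p : Fin 3 → ℝ} (hp : p ∈ cube 3) :
    1 ≤ (N:ℝ) - p 0 * p 1 * p 2 ∧ 1 ≤ (N:ℝ) - p 2 ∧ 1 ≤ (N:ℝ) - p 2 + p 0 * p 1 * p 2 ∧
      1 ≤ (N:ℝ) - p 0 * p 2 ∧ 1 ≤ (N:ℝ) - p 1 * p 2 := by
  have h2 : (2:ℝ) ≤ (N:ℝ) := by exact_mod_cast hN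
  have h0 := hp 0; have h1 := hp 1; have h3 := hp 2
  have h01 : 0 ≤ p 0 * p 1 ∧ p 0 * p 1 ≤ 1 := ⟨mul_nonneg h0.1 h1.1, mul_le_one₀ h0.2 h1.1 h1.2⟩
  have h012 : 0 ≤ p 0 * p 1 * p 2 ∧ p 0 * p 1 * p 2 ≤ 1 :=
    ⟨mul_nonneg h01.1 h3.1, mul_le_one₀ h01.2 h3.1 h3.2⟩
  have h02 : p 0 * p 2 ≤ 1 := mul_le_one₀ h0.2 h3.1 h3.2
  have h12 : p 1 * p 2 ≤ 1 := mul_le_one₀ h1.2 h3.1 h3.2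
  exact ⟨by linarith, by linarith, by linarith, by linarith, by linarith⟩

/-! ## The seven functions: values and derivative values -/

/-- `F₁ = 2t/(N − xyt)` on `□³`, with `∂ₜF₁ = 2N/(N − xyt)²`. [cite: KontsevichZagier2001, §1.1] -/
theorem exists_landen_F₁ {N : ℕ} (hN : 2 ≤ N) : ∃ T : RFun 3,
    (∀ p ∈ cube 3, T.fn p = 2 * p 2 / ((N:ℝ) - p 0 * p 1 * p 2)) ∧
    (∀ p ∈ cube 3, (T.pd 2).fn p = 2 * (N:ℝ) / ((N:ℝ) - p 0 * p 1 * p 2) ^ 2) := by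
  have hden : ∀ p ∈ cube 3, aeval p (C (N:ℚ) - X 0 * X 1 * X 2 : MvPolynomial (Fin 3) ℚ) ≠ 0 := by
    intro p hp
    have h := (landen_den_bounds hN hp).1
    simp only [map_sub, map_mul, aeval_C, aeval_X, eq_ratCast, Rat.cast_natCast]
    linarith
  refine ⟨⟨C 2 * X 2, _, hden⟩, fun p _ => ?_, fun p hp => ?_⟩
  · simp [RFun.fn_apply, mul_assoc]
  · have hne : (N:ℝ) - p 0 * p 1 * p 2 ≠ 0 := by linarith [(landen_den_bounds hN hp).1]
    rw [rfun_pd_fn_eq]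
    simp only [map_sub, map_mul, pderiv_mul, pderiv_C, pderiv_X, aeval_C, aeval_X, eq_ratCast,
      Rat.cast_natCast]
    norm_num [Pi.single_apply, Fin.ext_iff]
    field_simp
    ring

/-- `G₁ = 2x/(N − xyt)` on `□³`, with `∂ₓG₁ = 2N/(N − xyt)²`. [cite: KontsevichZagier2001, §1.1] -/
theorem exists_landen_G₁ {N : ℕ} (hN : 2 ≤ N) : ∃ T : RFun 3,
    (∀ p ∈ cube 3, T.fn p = 2 * p 0 / ((N:ℝ) - p 0 * p 1 * p 2)) ∧
    (∀ p ∈ cube 3, (T.pd 0).fn p = 2 * (N:ℝ) / ((N:ℝ) - p 0 * p 1 * p 2) ^ 2) := by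
  have hden : ∀ p ∈ cube 3, aeval p (C (N:ℚ) - X 0 * X 1 * X 2 : MvPolynomial (Fin 3) ℚ) ≠ 0 := by
    intro p hp
    have h := (landen_den_bounds hN hp).1
    simp only [map_sub, map_mul, aeval_C, aeval_X, eq_ratCast, Rat.cast_natCast]
    linarith
  refine ⟨⟨C 2 * X 0, _, hden⟩, fun p _ => ?_, fun p hp => ?_⟩
  · simp [RFun.fn_apply, mul_assoc]
  · have hne : (N:ℝ) - p 0 * p 1 * p 2 ≠ 0 := by linarith [(landen_den_bounds hN hp).1]
    rw [rfun_pd_fn_eq]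
    simp only [map_sub, map_mul, pderiv_mul, pderiv_C, pderiv_X, aeval_C, aeval_X, eq_ratCast,
      Rat.cast_natCast]
    norm_num [Pi.single_apply, Fin.ext_iff]
    field_simp
    ring

/-- `F₂ = −2t/(N − t + xyt)` on `□³`, with `∂ₜF₂ = −2N/(N − t + xyt)²`.
[cite: KontsevichZagier2001, §1.1] -/
theorem exists_landen_F₂ {N : ℕ} (hN : 2 ≤ N) : ∃ T : RFun 3,
    (∀ p ∈ cube 3, T.fn p = -(2 * p 2) / ((N:ℝ) - p 2 + p 0 * p 1 * p 2)) ∧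
    (∀ p ∈ cube 3, (T.pd 2).fn p = -(2 * (N:ℝ)) / ((N:ℝ) - p 2 + p 0 * p 1 * p 2) ^ 2) := by
  have hden : ∀ p ∈ cube 3,
      aeval p (C (N:ℚ) - X 2 + X 0 * X 1 * X 2 : MvPolynomial (Fin 3) ℚ) ≠ 0 := by
    intro p hp
    have h := (landen_den_bounds hN hp).2.2.1
    simp only [map_sub, map_add, map_mul, aeval_C, aeval_X, eq_ratCast, Rat.cast_natCast]
    linarith
  refine ⟨⟨-(C 2 * X 2), _, hden⟩, fun p _ => ?_, fun p hp => ?_⟩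
  · simp [RFun.fn_apply, mul_assoc]
  · have hne : (N:ℝ) - p 2 + p 0 * p 1 * p 2 ≠ 0 := by linarith [(landen_den_bounds hN hp).2.2.1]
    rw [rfun_pd_fn_eq]
    simp only [map_sub, map_add, map_mul, map_neg, pderiv_mul, pderiv_C, pderiv_X, aeval_C,
      aeval_X, eq_ratCast, Rat.cast_natCast]
    norm_num [Pi.single_apply, Fin.ext_iff]
    field_simp
    ring

/-- `G₂ = −2Nx/((N − t)(N − t + xyt))` on `□³`, with `∂ₓG₂ = −2N/(N − t + xyt)²`.
[cite: KontsevichZagier2001, §1.1] -/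
theorem exists_landen_G₂ {N : ℕ} (hN : 2 ≤ N) : ∃ T : RFun 3,
    (∀ p ∈ cube 3, T.fn p =
      -(2 * (N:ℝ) * p 0) / (((N:ℝ) - p 2) * ((N:ℝ) - p 2 + p 0 * p 1 * p 2))) ∧
    (∀ p ∈ cube 3, (T.pd 0).fn p = -(2 * (N:ℝ)) / ((N:ℝ) - p 2 + p 0 * p 1 * p 2) ^ 2) := by
  have hden : ∀ p ∈ cube 3,
      aeval p ((C (N:ℚ) - X 2) * (C (N:ℚ) - X 2 + X 0 * X 1 * X 2) : MvPolynomial (Fin 3) ℚ) ≠ 0 := by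
    intro p hp
    have h := landen_den_bounds hN hp
    simp only [map_sub, map_add, map_mul, aeval_C, aeval_X, eq_ratCast, Rat.cast_natCast]
    exact mul_ne_zero (by linarith [h.2.1]) (by linarith [h.2.2.1])
  refine ⟨⟨-(C (2 * (N:ℚ)) * X 0), _, hden⟩, fun p _ => ?_, fun p hp => ?_⟩
  · simp [RFun.fn_apply]
  · have h := landen_den_bounds hN hp
    have ht : (N:ℝ) - p 2 ≠ 0 := by linarith [h.2.1]
    have h2 : (N:ℝ) - p 2 + p 0 * p 1 * p 2 ≠ 0 := by linarith [h.2.2.1]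
    rw [rfun_pd_fn_eq]
    simp only [map_sub, map_add, map_mul, map_neg, pderiv_mul, pderiv_C, pderiv_X, aeval_C,
      aeval_X, eq_ratCast, Rat.cast_natCast]
    norm_num [Pi.single_apply, Fin.ext_iff]
    field_simp
    ring

/-- `F₃ = t²/((N − xt)(N − yt))` on `□³`, with `∂ₜF₃ = Nt/((N − xt)²(N − yt)) + Nt/((N − xt)(N − yt)²)`.
[cite: KontsevichZagier2001, §1.1] -/
theorem exists_landen_F₃ {N : ℕ} (hN : 2 ≤ N) : ∃ T : RFun 3,
    (∀ p ∈ cube 3, T.fn p = p 2 ^ 2 / (((N:ℝ) - p 0 * p 2) * ((N:ℝ) - p 1 * p 2))) ∧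
    (∀ p ∈ cube 3, (T.pd 2).fn p =
      (N:ℝ) * p 2 / (((N:ℝ) - p 0 * p 2) ^ 2 * ((N:ℝ) - p 1 * p 2)) +
        (N:ℝ) * p 2 / (((N:ℝ) - p 0 * p 2) * ((N:ℝ) - p 1 * p 2) ^ 2)) := by
  have hden : ∀ p ∈ cube 3,
      aeval p ((C (N:ℚ) - X 0 * X 2) * (C (N:ℚ) - X 1 * X 2) : MvPolynomial (Fin 3) ℚ) ≠ 0 := by
    intro p hp
    have h := landen_den_bounds hN hp
    simp only [map_sub, map_mul, aeval_C, aeval_X, eq_ratCast, Rat.cast_natCast]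
    exact mul_ne_zero (by linarith [h.2.2.2.1]) (by linarith [h.2.2.2.2])
  refine ⟨⟨X 2 ^ 2, _, hden⟩, fun p _ => ?_, fun p hp => ?_⟩
  · simp [RFun.fn_apply]
  · have h := landen_den_bounds hN hp
    have hx : (N:ℝ) - p 0 * p 2 ≠ 0 := by linarith [h.2.2.2.1]
    have hy : (N:ℝ) - p 1 * p 2 ≠ 0 := by linarith [h.2.2.2.2]
    rw [rfun_pd_fn_eq]
    simp only [map_sub, map_mul, map_pow, pderiv_mul, pderiv_pow, pderiv_C, pderiv_X, aeval_C,
      aeval_X, eq_ratCast, Rat.cast_natCast]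
    norm_num [Pi.single_apply, Fin.ext_iff]
    field_simp
    ring

/-- `G₃ = xt/((N − xt)(N − yt))` on `□³`, with `∂ₓG₃ = Nt/((N − xt)²(N − yt))`.
[cite: KontsevichZagier2001, §1.1] -/
theorem exists_landen_G₃ {N : ℕ} (hN : 2 ≤ N) : ∃ T : RFun 3,
    (∀ p ∈ cube 3, T.fn p = p 0 * p 2 / (((N:ℝ) - p 0 * p 2) * ((N:ℝ) - p 1 * p 2))) ∧
    (∀ p ∈ cube 3, (T.pd 0).fn p =
      (N:ℝ) * p 2 / (((N:ℝ) - p 0 * p 2) ^ 2 * ((N:ℝ) - p 1 * p 2))) := by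
  have hden : ∀ p ∈ cube 3,
      aeval p ((C (N:ℚ) - X 0 * X 2) * (C (N:ℚ) - X 1 * X 2) : MvPolynomial (Fin 3) ℚ) ≠ 0 := by
    intro p hp
    have h := landen_den_bounds hN hp
    simp only [map_sub, map_mul, aeval_C, aeval_X, eq_ratCast, Rat.cast_natCast]
    exact mul_ne_zero (by linarith [h.2.2.2.1]) (by linarith [h.2.2.2.2])
  refine ⟨⟨X 0 * X 2, _, hden⟩, fun p _ => ?_, fun p hp => ?_⟩
  · simp [RFun.fn_apply]
  · have h := landen_den_bounds hN hp
    have hx : (N:ℝ) - p 0 * p 2 ≠ 0 := by linarith [h.2.2.2.1]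
    have hy : (N:ℝ) - p 1 * p 2 ≠ 0 := by linarith [h.2.2.2.2]
    rw [rfun_pd_fn_eq]
    simp only [map_sub, map_mul, pderiv_mul, pderiv_C, pderiv_X, aeval_C, aeval_X, eq_ratCast,
      Rat.cast_natCast]
    norm_num [Pi.single_apply, Fin.ext_iff]
    field_simp
    ring

/-- `H₃ = yt/((N − xt)(N − yt))` on `□³`, with `∂_yH₃ = Nt/((N − xt)(N − yt)²)`.
[cite: KontsevichZagier2001, §1.1] -/
theorem exists_landen_H₃ {N : ℕ} (hN : 2 ≤ N) : ∃ T : RFun 3,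
    (∀ p ∈ cube 3, T.fn p = p 1 * p 2 / (((N:ℝ) - p 0 * p 2) * ((N:ℝ) - p 1 * p 2))) ∧
    (∀ p ∈ cube 3, (T.pd 1).fn p =
      (N:ℝ) * p 2 / (((N:ℝ) - p 0 * p 2) * ((N:ℝ) - p 1 * p 2) ^ 2)) := by
  have hden : ∀ p ∈ cube 3,
      aeval p ((C (N:ℚ) - X 0 * X 2) * (C (N:ℚ) - X 1 * X 2) : MvPolynomial (Fin 3) ℚ) ≠ 0 := by
    intro p hp
    have h := landen_den_bounds hN hp
    simp only [map_sub, map_mul, aeval_C, aeval_X, eq_ratCast, Rat.cast_natCast]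
    exact mul_ne_zero (by linarith [h.2.2.2.1]) (by linarith [h.2.2.2.2])
  refine ⟨⟨X 1 * X 2, _, hden⟩, fun p _ => ?_, fun p hp => ?_⟩
  · simp [RFun.fn_apply]
  · have h := landen_den_bounds hN hp
    have hx : (N:ℝ) - p 0 * p 2 ≠ 0 := by linarith [h.2.2.2.1]
    have hy : (N:ℝ) - p 1 * p 2 ≠ 0 := by linarith [h.2.2.2.2]
    rw [rfun_pd_fn_eq]
    simp only [map_sub, map_mul, pderiv_mul, pderiv_C, pderiv_X, aeval_C, aeval_X, eq_ratCast,
      Rat.cast_natCast]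
    norm_num [Pi.single_apply, Fin.ext_iff]
    field_simp
    ring

/-! ## The registered sub-goal stub -/

/-- **Stub `stub_landenPrimitives`** (sub-goal of crux `ReductionRigidity`, stmt-3407, line `Sketch`,
growth deliverable G4, part 1): the seven regular rational functions `F₁, G₁, F₂, G₂, F₃, G₃, H₃` on the
closed cube `□³` realising the Landen certificate exist, with the stated values and the stated values
of `∂ₜF₁, ∂ₓG₁, ∂ₜF₂, ∂ₓG₂, ∂ₜF₃, ∂ₓG₃, ∂_yH₃` on the cube — in particular `∂ₜF₁ = ∂ₓG₁`,
`∂ₜF₂ = ∂ₓG₂` and `∂ₜF₃ = ∂ₓG₃ + ∂_yH₃` pointwise (the exactness behind the dimension-raising Stokes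
move). [cite: KontsevichZagier2001, §1.2 rule (3)] -/
theorem stub_landenPrimitives :
    ∀ (N : ℕ), 2 ≤ N → ∃ F₁ G₁ F₂ G₂ F₃ G₃ H₃ : RFun 3,
      (∀ p ∈ cube 3, F₁.fn p = 2 * p 2 / ((N:ℝ) - p 0 * p 1 * p 2)) ∧
      (∀ p ∈ cube 3, (F₁.pd 2).fn p = 2 * (N:ℝ) / ((N:ℝ) - p 0 * p 1 * p 2) ^ 2) ∧
      (∀ p ∈ cube 3, G₁.fn p = 2 * p 0 / ((N:ℝ) - p 0 * p 1 * p 2)) ∧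
      (∀ p ∈ cube 3, (G₁.pd 0).fn p = 2 * (N:ℝ) / ((N:ℝ) - p 0 * p 1 * p 2) ^ 2) ∧
      (∀ p ∈ cube 3, F₂.fn p = -(2 * p 2) / ((N:ℝ) - p 2 + p 0 * p 1 * p 2)) ∧
      (∀ p ∈ cube 3, (F₂.pd 2).fn p = -(2 * (N:ℝ)) / ((N:ℝ) - p 2 + p 0 * p 1 * p 2) ^ 2) ∧
      (∀ p ∈ cube 3, G₂.fn p =
        -(2 * (N:ℝ) * p 0) / (((N:ℝ) - p 2) * ((N:ℝ) - p 2 + p 0 * p 1 * p 2))) ∧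
      (∀ p ∈ cube 3, (G₂.pd 0).fn p = -(2 * (N:ℝ)) / ((N:ℝ) - p 2 + p 0 * p 1 * p 2) ^ 2) ∧
      (∀ p ∈ cube 3, F₃.fn p = p 2 ^ 2 / (((N:ℝ) - p 0 * p 2) * ((N:ℝ) - p 1 * p 2))) ∧
      (∀ p ∈ cube 3, (F₃.pd 2).fn p =
        (N:ℝ) * p 2 / (((N:ℝ) - p 0 * p 2) ^ 2 * ((N:ℝ) - p 1 * p 2)) +
          (N:ℝ) * p 2 / (((N:ℝ) - p 0 * p 2) * ((N:ℝ) - p 1 * p 2) ^ 2)) ∧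
      (∀ p ∈ cube 3, G₃.fn p = p 0 * p 2 / (((N:ℝ) - p 0 * p 2) * ((N:ℝ) - p 1 * p 2))) ∧
      (∀ p ∈ cube 3, (G₃.pd 0).fn p =
        (N:ℝ) * p 2 / (((N:ℝ) - p 0 * p 2) ^ 2 * ((N:ℝ) - p 1 * p 2))) ∧
      (∀ p ∈ cube 3, H₃.fn p = p 1 * p 2 / (((N:ℝ) - p 0 * p 2) * ((N:ℝ) - p 1 * p 2))) ∧
      (∀ p ∈ cube 3, (H₃.pd 1).fn p =
        (N:ℝ) * p 2 / (((N:ℝ) - p 0 * p 2) * ((N:ℝ) - p 1 * p 2) ^ 2)) := by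
  intro N hN
  obtain ⟨F₁, hF₁, hF₁'⟩ := exists_landen_F₁ hN
  obtain ⟨G₁, hG₁, hG₁'⟩ := exists_landen_G₁ hN
  obtain ⟨F₂, hF₂, hF₂'⟩ := exists_landen_F₂ hN
  obtain ⟨G₂, hG₂, hG₂'⟩ := exists_landen_G₂ hN
  obtain ⟨F₃, hF₃, hF₃'⟩ := exists_landen_F₃ hN
  obtain ⟨G₃, hG₃, hG₃'⟩ := exists_landen_G₃ hN
  obtain ⟨H₃, hH₃, hH₃'⟩ := exists_landen_H₃ hN
  exact ⟨F₁, G₁, F₂, G₂, F₃, G₃, H₃, hF₁, hF₁', hG₁, hG₁', hF₂, hF₂', hG₂, hG₂', hF₃, hF₃', hG₃,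
    hG₃', hH₃, hH₃'⟩

end Summit.KontsevichZagierPeriods.HermiteRigidity.ReductionRigidity

end
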